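import Mathlib.Data.List.Count
import Mathlib.Data.Nat.Basic
import Literature.Computability.Complexity.CNFRelabel
import HarnessLib

/-!
# Cardinality constraints in CNF: the sequential counter

A CNF encoding, with fully proved semantics, of the Boolean cardinality constraint
"at least `k` of the literals `l₁, …, lₙ` are true", following the *sequential (unary) counter*
of Sinz (CP 2005, §2, encoding `LT_SEQ`): auxiliary bits `s_{i,j}` ("at least `j` of the first
`i` literals are true", `0 ≤ i ≤ n`, `1 ≤ j ≤ k`) propagated from literal `i` to literal `i+1` by
clauses of width `≤ 3`. Sinz states the `≤ k` form; we use the dual `≥ k` form in which the bits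
only need to be *upper bounds of the truth* (one implication direction), which is what a
refutation needs:

* `(¬ s_{0,j})` for `1 ≤ j ≤ k`;
* `s_{i+1,j} → s_{i,j} ∨ l_{i+1}` and, for `j ≥ 2`, `s_{i+1,j} → s_{i,j} ∨ s_{i,j-1}`;
* the goal unit clause `(s_{n,k})`.

`2nk` ternary clauses, `k` + `1` unit clauses, `(n+1)k` auxiliary variables (we do not prune the
unreachable corner bits; simplicity of the proofs beats the `3k+1` clauses saved in [Sinz 2005]).

## Main statements (all proved)

* `seqCounter k ls : CNF (ν ⊕ ℕ × ℕ)` — base variables `Sum.inl x`, auxiliary bits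
  `Sum.inr (i, j)`;
* `seqCounter_sound` — every satisfying assignment `τ` has `k ≤ countTrue (τ ∘ Sum.inl) ls`;
* `seqCounterWitness σ ls` and `seqCounter_complete` — conversely every base assignment `σ` with
  `k ≤ countTrue σ ls` extends (explicitly: `s_{i,j} := [j ≤ #true among the first i]`) to a
  satisfying assignment;
* `seqCounter_satisfiable_iff` — hence `seqCounter k ls` is satisfiable iff some `σ` makes at
  least `k` of the literals true;
* `mem_varSet_seqCounter` — the variables used (needed for dense renumbering downstream):
  base variables of `ls`, and bits `(i, j)` with `i ≤ n`, `j ≤ k`.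

The combination "CNF + several cardinality constraints ↦ one CNF over `ℕ`" is
`CardinalityCCNF.lean`.

## References

* C. Sinz, *Towards an optimal CNF encoding of Boolean cardinality constraints*, CP 2005, LNCS
  3709, 827–831, §2 (sequential counter `LT^{n,k}_{SEQ}`). [cite: Sinz2005, §2]
-/

namespace Literature.Computability.Complexity

universe u

variable {ν : Type u}

/-! ### Clause evaluation helpers -/

/-- The empty clause is false. [folklore] -/
@[simp] theorem Clause.eval_nil (σ : ν → Bool) : Clause.eval σ ([] : Clause ν) = false := rfl

/-- Unfolding the value of a clause on a cons: `l ∨ c`. [folklore] -/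
@[simp] theorem Clause.eval_cons (σ : ν → Bool) (l : Literal ν) (c : Clause ν) :
    Clause.eval σ (l :: c) = (l.eval σ || Clause.eval σ c) := rfl

/-- The value of a positive literal. [folklore] -/
@[simp] theorem Literal.eval_mk_true (σ : ν → Bool) (x : ν) :
    Literal.eval σ (x, true) = σ x := by
  simp [Literal.eval]

/-- The value of a negative literal. [folklore] -/
@[simp] theorem Literal.eval_mk_false (σ : ν → Bool) (x : ν) :
    Literal.eval σ (x, false) = !σ x := by
  simp [Literal.eval]

/-! ### Counting true literals -/

/-- The number of literals of the list `ls` that are true under `σ` (assignment first, so that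
it partially applies; eta-equal to `Clause.trueCount` of `SharpSATNormalForm.lean`, whose
counting-complexity import closure is not wanted here). [folklore] -/
def countTrue (σ : ν → Bool) (ls : List (Literal ν)) : ℕ :=
  ls.countP (Literal.eval σ)

/-- No literals, none true. [folklore] -/
@[simp] theorem countTrue_nil (σ : ν → Bool) : countTrue σ ([] : List (Literal ν)) = 0 := rfl

/-- Counting true literals over a concatenation. [folklore] -/
theorem countTrue_append (σ : ν → Bool) (ls ls' : List (Literal ν)) :
    countTrue σ (ls ++ ls') = countTrue σ ls + countTrue σ ls' :=
  List.countP_append ..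

/-- Counting true literals over a singleton. [folklore] -/
@[simp] theorem countTrue_singleton (σ : ν → Bool) (l : Literal ν) :
    countTrue σ [l] = if l.eval σ = true then 1 else 0 := by
  simp [countTrue]

/-- At most all literals are true. [folklore] -/
theorem countTrue_le_length (σ : ν → Bool) (ls : List (Literal ν)) :
    countTrue σ ls ≤ ls.length :=
  List.countP_le_length

/-- The count of true positive literals on distinct variables `xs` is the number of `x ∈ xs`
with `σ x = true`. [folklore] -/
theorem countTrue_map_mk_true (σ : ν → Bool) (xs : List ν) :
    countTrue σ (xs.map fun x => (x, true)) = xs.countP fun x => σ x := by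
  simp only [countTrue, List.countP_map]
  congr 1
  funext x
  simp

/-- Counting true literals only depends on the pulled-back assignment after relabelling.
[folklore] -/
theorem countTrue_map_relabel {μ : Type*} (f : ν → μ) (τ : μ → Bool) (ls : List (Literal ν)) :
    countTrue τ (ls.map (Literal.relabel f)) = countTrue (τ ∘ f) ls := by
  simp only [countTrue, List.countP_map]
  rfl

/-! ### The sequential counter -/

section SeqCounter

/-- The clauses linking row `i` to row `i + 1` of the counter for the `(i+1)`-st literal `l`:
for `1 ≤ j ≤ k`, `¬s_{i+1,j} ∨ s_{i,j} ∨ l` and, if `j ≥ 2`, `¬s_{i+1,j} ∨ s_{i,j} ∨ s_{i,j-1}`.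
[cite: Sinz2005, §2] -/
def seqCounterStep (k i : ℕ) (l : Literal ν) : CNF (ν ⊕ ℕ × ℕ) :=
  (List.range' 1 k).flatMap fun j =>
    [(Sum.inr (i + 1, j), false), (Sum.inr (i, j), true), l.relabel Sum.inl] ::
      (if 2 ≤ j then
        [[(Sum.inr (i + 1, j), false), (Sum.inr (i, j), true), (Sum.inr (i, j - 1), true)]]
      else [])

/-- The linking clauses for the literals `ls`, the first of which has position `i + 1`.
[cite: Sinz2005, §2] -/
def seqCounterAux (k : ℕ) : ℕ → List (Literal ν) → CNF (ν ⊕ ℕ × ℕ)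
  | _, [] => []
  | i, l :: ls => seqCounterStep k i l ++ seqCounterAux k (i + 1) ls

/-- **Sequential-counter CNF for "at least `k` of the literals `ls` are true"** over the
variables `ν ⊕ ℕ × ℕ` (`Sum.inl x` = base variable `x`, `Sum.inr (i, j)` = counter bit
`s_{i,j}`): the unit clauses `¬s_{0,j}` (`1 ≤ j ≤ k`), the linking clauses, and the goal
`s_{n,k}` (`n = ls.length`). See `seqCounter_satisfiable_iff`. [cite: Sinz2005, §2] -/
def seqCounter (k : ℕ) (ls : List (Literal ν)) : CNF (ν ⊕ ℕ × ℕ) :=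
  (List.range' 1 k).map (fun j => [(Sum.inr (0, j), false)]) ++
    (seqCounterAux k 0 ls ++ [[(Sum.inr (ls.length, k), true)]])

/-- The soundness invariant of row `i`: every set bit `s_{i,j}` (`1 ≤ j ≤ k`) certifies
`j ≤ cnt`, where `cnt` will be the number of true literals among the first `i`.
[cite: Sinz2005, §2] -/
def SeqCounterInv (k : ℕ) (τ : ν ⊕ ℕ × ℕ → Bool) (cnt i : ℕ) : Prop :=
  ∀ j, 1 ≤ j → j ≤ k → τ (Sum.inr (i, j)) = true → j ≤ cnt

variable {k : ℕ} {τ : ν ⊕ ℕ × ℕ → Bool}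

/-- One propagation step of the soundness invariant. [cite: Sinz2005, §2] -/
theorem seqCounterStep_sound {i : ℕ} {l : Literal ν} (h : (seqCounterStep k i l).eval τ = true)
    {cnt : ℕ} (hinv : SeqCounterInv k τ cnt i) :
    SeqCounterInv k τ (cnt + countTrue (τ ∘ Sum.inl) [l]) (i + 1) := by
  intro j hj1 hjk hs
  rw [CNF.eval_eq_true_iff] at h
  have hjmem : j ∈ List.range' 1 k := by simp; omega
  -- the first linking clause
  have hC1 := h _ (List.mem_flatMap.2 ⟨j, hjmem, List.mem_cons_self⟩)
  simp only [Clause.eval_cons, Clause.eval_nil, Literal.eval_mk_false, Literal.eval_mk_true, hs,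
    Literal.eval_relabel, Bool.or_false, Bool.not_true, Bool.false_or, Bool.or_eq_true] at hC1
  by_cases hprev : τ (Sum.inr (i, j)) = true
  · exact (hinv j hj1 hjk hprev).trans (Nat.le_add_right _ _)
  · have hl : l.eval (τ ∘ Sum.inl) = true := by
      rcases hC1 with h1 | h1
      · exact absurd h1 hprev
      · exact h1
    simp only [countTrue_singleton, hl, if_true]
    rcases Nat.lt_or_ge j 2 with hj2 | hj2
    · omega
    · -- the second linking clause
      have hC2 := h [(Sum.inr (i + 1, j), false), (Sum.inr (i, j), true),
        (Sum.inr (i, j - 1), true)] (List.mem_flatMap.2 ⟨j, hjmem, by simp [hj2]⟩)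
      simp only [Clause.eval_cons, Clause.eval_nil, Literal.eval_mk_false, Literal.eval_mk_true,
        hs, Bool.not_true, Bool.false_or, Bool.or_false, Bool.or_eq_true] at hC2
      rcases hC2 with h2 | h2
      · exact absurd h2 hprev
      · have := hinv (j - 1) (by omega) (by omega) h2
        omega

/-- Propagation of the soundness invariant along all of `ls`. [cite: Sinz2005, §2] -/
theorem seqCounterAux_sound (ls : List (Literal ν)) {i cnt : ℕ}
    (h : (seqCounterAux k i ls).eval τ = true) (hinv : SeqCounterInv k τ cnt i) :
    SeqCounterInv k τ (cnt + countTrue (τ ∘ Sum.inl) ls) (i + ls.length) := by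
  induction ls generalizing i cnt with
  | nil => simpa using hinv
  | cons l ls ih =>
    simp only [seqCounterAux, CNF.eval_append_eq_true_iff] at h
    have h1 := seqCounterStep_sound h.1 hinv
    have h2 := ih h.2 h1
    have e1 : cnt + countTrue (τ ∘ Sum.inl) [l] + countTrue (τ ∘ Sum.inl) ls =
        cnt + countTrue (τ ∘ Sum.inl) (l :: ls) := by
      rw [show l :: ls = [l] ++ ls from rfl, countTrue_append, Nat.add_assoc]
    have e2 : i + 1 + ls.length = i + (l :: ls).length := by simp; omega
    rwa [e1, e2] at h2

/-- **Soundness of the sequential counter**: under any satisfying assignment at least `k` of the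
literals are true (for the base part `τ ∘ Sum.inl` of the assignment). [cite: Sinz2005, §2] -/
theorem seqCounter_sound {ls : List (Literal ν)} (h : (seqCounter k ls).eval τ = true) :
    k ≤ countTrue (τ ∘ Sum.inl) ls := by
  simp only [seqCounter, CNF.eval_append_eq_true_iff] at h
  obtain ⟨h0, hmid, hgoal⟩ := h
  have hinv0 : SeqCounterInv k τ 0 0 := by
    intro j hj1 hjk hs
    rw [CNF.eval_eq_true_iff] at h0
    have := h0 [(Sum.inr (0, j), false)] (List.mem_map.2 ⟨j, by simp; omega, rfl⟩)
    simp [hs] at this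
  have hinv := seqCounterAux_sound ls hmid hinv0
  simp only [Nat.zero_add] at hinv
  rcases Nat.eq_zero_or_pos k with hk | hk
  · omega
  · refine hinv k hk le_rfl ?_
    simpa [CNF.eval] using hgoal

/-- The canonical extension of a base assignment `σ` to the counter bits:
`s_{i,j} := [j ≤ number of true literals among the first i]`. [cite: Sinz2005, §2] -/
def seqCounterWitness (σ : ν → Bool) (ls : List (Literal ν)) : ν ⊕ ℕ × ℕ → Bool
  | Sum.inl x => σ x
  | Sum.inr p => decide (p.2 ≤ countTrue σ (ls.take p.1))

/-- The witness restricts to `σ` on the base variables. [cite: Sinz2005, §2] -/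
@[simp] theorem seqCounterWitness_inl (σ : ν → Bool) (ls : List (Literal ν)) (x : ν) :
    seqCounterWitness σ ls (Sum.inl x) = σ x := rfl

/-- The witness on a counter bit. [cite: Sinz2005, §2] -/
@[simp] theorem seqCounterWitness_inr (σ : ν → Bool) (ls : List (Literal ν)) (i j : ℕ) :
    seqCounterWitness σ ls (Sum.inr (i, j)) = decide (j ≤ countTrue σ (ls.take i)) := rfl

/-- The base part of the witness is `σ`. [cite: Sinz2005, §2] -/
theorem seqCounterWitness_comp_inl (σ : ν → Bool) (ls : List (Literal ν)) :
    seqCounterWitness σ ls ∘ Sum.inl = σ := rfl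

/-- Taking `|pre|` elements of `pre ++ l :: ls` gives `pre`. [folklore] -/
private theorem take_length_append (pre : List (Literal ν)) (l : Literal ν)
    (ls : List (Literal ν)) : (pre ++ l :: ls).take pre.length = pre := by
  induction pre with
  | nil => rfl
  | cons a pre ih => simp [ih]

/-- Taking `|pre| + 1` elements of `pre ++ l :: ls` gives `pre ++ [l]`. [folklore] -/
private theorem take_length_succ_append (pre : List (Literal ν)) (l : Literal ν)
    (ls : List (Literal ν)) : (pre ++ l :: ls).take (pre.length + 1) = pre ++ [l] := by
  induction pre with
  | nil => rfl
  | cons a pre ih => simp [ih]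

/-- The linking clauses hold under the witness (the suffix `ls` of `full = pre ++ ls` starts at
position `pre.length`). [cite: Sinz2005, §2] -/
theorem seqCounterAux_complete (σ : ν → Bool) (full : List (Literal ν)) :
    ∀ (pre ls : List (Literal ν)), full = pre ++ ls →
      (seqCounterAux k pre.length ls).eval (seqCounterWitness σ full) = true := by
  intro pre ls
  induction ls generalizing pre with
  | nil => intro; rfl
  | cons l ls ih =>
    intro hfull
    simp only [seqCounterAux, CNF.eval_append_eq_true_iff]
    refine ⟨?_, ?_⟩
    · -- the step clauses at position `pre.length`
      rw [CNF.eval_eq_true_iff]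
      intro c hc
      simp only [seqCounterStep, List.mem_flatMap, List.mem_cons] at hc
      obtain ⟨j, hj, hc⟩ := hc
      have hj' : 1 ≤ j ∧ j ≤ k := by simp at hj; omega
      have ht0 : countTrue σ (full.take pre.length) = countTrue σ pre := by
        rw [hfull, take_length_append]
      have ht1 : countTrue σ (full.take (pre.length + 1)) = countTrue σ pre + countTrue σ [l] := by
        rw [hfull, take_length_succ_append, countTrue_append]
      have hle : countTrue σ [l] ≤ 1 := by
        simpa using countTrue_le_length σ [l]
      rcases hc with rfl | hc
      · simp only [Clause.eval_cons, Clause.eval_nil, Literal.eval_mk_false, Literal.eval_mk_true,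
          seqCounterWitness_inr, Literal.eval_relabel, seqCounterWitness_comp_inl, Bool.or_false,
          Bool.or_eq_true, Bool.not_eq_true', decide_eq_false_iff_not, decide_eq_true_eq, ht0, ht1]
        by_cases hl : l.eval σ = true
        · exact Or.inr (Or.inr hl)
        · have h0 : countTrue σ [l] = 0 := by simp [hl]
          rw [h0, Nat.add_zero]
          exact (em (j ≤ countTrue σ pre)).elim (fun h => Or.inr (Or.inl h)) Or.inl
      · split_ifs at hc with hj2
        · simp only [List.mem_singleton] at hc
          subst hc
          simp only [Clause.eval_cons, Clause.eval_nil, Literal.eval_mk_false,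
            Literal.eval_mk_true, seqCounterWitness_inr, Bool.or_false, Bool.or_eq_true,
            Bool.not_eq_true', decide_eq_false_iff_not, decide_eq_true_eq, ht0, ht1]
          omega
        · simp at hc
    · have := ih (pre ++ [l]) (by simpa using hfull)
      simpa using this

/-- **Completeness of the sequential counter**: if at least `k` literals are true under `σ`, the
witness extension of `σ` satisfies `seqCounter k ls`. [cite: Sinz2005, §2] -/
theorem seqCounter_complete {σ : ν → Bool} {ls : List (Literal ν)} (h : k ≤ countTrue σ ls) :
    (seqCounter k ls).eval (seqCounterWitness σ ls) = true := by
  simp only [seqCounter, CNF.eval_append_eq_true_iff]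
  refine ⟨?_, ?_, ?_⟩
  · rw [CNF.eval_eq_true_iff]
    intro c hc
    obtain ⟨j, hj, rfl⟩ := List.mem_map.1 hc
    have hj' : 1 ≤ j := by simp at hj; omega
    simp only [Clause.eval_cons, Clause.eval_nil, Literal.eval_mk_false, seqCounterWitness_inr,
      List.take_zero, countTrue_nil, Bool.or_false, Bool.not_eq_true', decide_eq_false_iff_not]
    omega
  · simpa using seqCounterAux_complete (k := k) σ ls [] ls rfl
  · simp [CNF.eval, h]

/-- **The sequential counter is an exact encoding**: `seqCounter k ls` is satisfiable iff some
assignment makes at least `k` of the literals `ls` true. [cite: Sinz2005, §2] -/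
theorem seqCounter_satisfiable_iff (k : ℕ) (ls : List (Literal ν)) :
    (seqCounter k ls).Satisfiable ↔ ∃ σ : ν → Bool, k ≤ countTrue σ ls :=
  ⟨fun ⟨_, hτ⟩ => ⟨_, seqCounter_sound hτ⟩,
    fun ⟨σ, hσ⟩ => ⟨seqCounterWitness σ ls, seqCounter_complete hσ⟩⟩

/-! ### The variables used by the counter -/

/-- The variables of a step clause: the base variable of `l`, and bits in rows `i`, `i+1`,
columns `≤ k`. [cite: Sinz2005, §2] -/
theorem mem_varSet_seqCounterStep {k i : ℕ} {l : Literal ν} {x : ν ⊕ ℕ × ℕ}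
    (hx : x ∈ (seqCounterStep k i l).varSet) :
    x = Sum.inl l.1 ∨ ∃ i' j, (i' = i ∨ i' = i + 1) ∧ j ≤ k ∧ x = Sum.inr (i', j) := by
  obtain ⟨c, hc, l', hl', rfl⟩ := hx
  simp only [seqCounterStep, List.mem_flatMap, List.mem_cons] at hc
  obtain ⟨j, hj, hc⟩ := hc
  have hj' : 1 ≤ j ∧ j ≤ k := by simp at hj; omega
  rcases hc with rfl | hc
  · simp only [List.mem_cons, List.not_mem_nil, or_false] at hl'
    rcases hl' with rfl | rfl | rfl
    · exact Or.inr ⟨i + 1, j, Or.inr rfl, hj'.2, rfl⟩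
    · exact Or.inr ⟨i, j, Or.inl rfl, hj'.2, rfl⟩
    · exact Or.inl rfl
  · split_ifs at hc with hj2
    · simp only [List.mem_singleton] at hc
      subst hc
      simp only [List.mem_cons, List.not_mem_nil, or_false] at hl'
      rcases hl' with rfl | rfl | rfl
      · exact Or.inr ⟨i + 1, j, Or.inr rfl, hj'.2, rfl⟩
      · exact Or.inr ⟨i, j, Or.inl rfl, hj'.2, rfl⟩
      · exact Or.inr ⟨i, j - 1, Or.inl rfl, by omega, rfl⟩
    · simp at hc

/-- The variables of the linking clauses for a suffix starting at position `i`. [cite: Sinz2005, §2] -/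
theorem mem_varSet_seqCounterAux {k : ℕ} (ls : List (Literal ν)) {i : ℕ} {x : ν ⊕ ℕ × ℕ}
    (hx : x ∈ (seqCounterAux k i ls).varSet) :
    (∃ l ∈ ls, x = Sum.inl l.1) ∨ ∃ i' j, i ≤ i' ∧ i' ≤ i + ls.length ∧ j ≤ k ∧
      x = Sum.inr (i', j) := by
  induction ls generalizing i with
  | nil => simp [seqCounterAux, CNF.varSet] at hx
  | cons l ls ih =>
    simp only [seqCounterAux, CNF.varSet_append, Set.mem_union] at hx
    rcases hx with hx | hx
    · rcases mem_varSet_seqCounterStep hx with rfl | ⟨i', j, hi', hj, rfl⟩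
      · exact Or.inl ⟨l, List.mem_cons_self, rfl⟩
      · refine Or.inr ⟨i', j, by omega, ?_, hj, rfl⟩
        simp; omega
    · rcases ih hx with ⟨l', hl', rfl⟩ | ⟨i', j, hi', hi'', hj, rfl⟩
      · exact Or.inl ⟨l', List.mem_cons_of_mem _ hl', rfl⟩
      · refine Or.inr ⟨i', j, by omega, ?_, hj, rfl⟩
        simp at hi'' ⊢; omega

/-- **The variables of `seqCounter k ls`**: base variables of `ls`, or bits `(i, j)` with
`i ≤ ls.length` and `j ≤ k`. [cite: Sinz2005, §2] -/
theorem mem_varSet_seqCounter {k : ℕ} {ls : List (Literal ν)} {x : ν ⊕ ℕ × ℕ}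
    (hx : x ∈ (seqCounter k ls).varSet) :
    (∃ l ∈ ls, x = Sum.inl l.1) ∨ ∃ i j, i ≤ ls.length ∧ j ≤ k ∧ x = Sum.inr (i, j) := by
  simp only [seqCounter, CNF.varSet_append, Set.mem_union] at hx
  rcases hx with hx | hx | hx
  · obtain ⟨c, hc, l', hl', rfl⟩ := hx
    obtain ⟨j, hj, rfl⟩ := List.mem_map.1 hc
    have hj' : j ≤ k := by simp at hj; omega
    simp only [List.mem_singleton] at hl'
    subst hl'
    exact Or.inr ⟨0, j, Nat.zero_le _, hj', rfl⟩
  · rcases mem_varSet_seqCounterAux ls hx with h | ⟨i', j, -, hi'', hj, rfl⟩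
    · exact Or.inl h
    · exact Or.inr ⟨i', j, by simpa using hi'', hj, rfl⟩
  · obtain ⟨c, hc, l', hl', rfl⟩ := hx
    simp only [List.mem_singleton] at hc
    subst hc
    simp only [List.mem_singleton] at hl'
    subst hl'
    exact Or.inr ⟨ls.length, k, le_rfl, le_rfl, rfl⟩

end SeqCounter

end Literature.Computability.Complexity
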